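import Summits.QuantumFields.BalabanUV.Beta.FP.NestedDressingStepLaw

/-!
# `BalabanUV.Beta.FP.NestedDressingDescent` — road «FP» for binder row D1, (STEP) door, PROPOSED RULING R-FP-45 (B), the coarse dictionary row (β-c) AT MODEL LEVEL:
# `Π_nest = Π₁ · G` WITH THE COARSE GAUGE ADJUSTMENT `G := 1 − W₂(S^c Q₁W₂)⁻¹S^c Q₁` (`Q₁G = Π^c Q₁`, `Π^c := 1 − (Q₁W₂)(S^c Q₁W₂)⁻¹S^c` the BLOCK-LEVEL projector),
# AND THE NESTED DRESSING DESCENDS TO THE BLOCK FORM: the physical corner of the effective form of the nested-dressed system is the block-level congruence of the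
# effective form of the ONE-STEP-dressed system, `(𝒮(Π_nestᵀHΠ_nest,[Q₁;τ₁]))₁₁ = (Mᵀ·𝒮(Π₁ᵀHΠ₁,[Q₁;τ₁])·M)₁₁`, `M := [[Π^c, 0],[−τ₁W₂(S^cQ₁W₂)⁻¹S^c, 1]]` — and hence, when the
# one-step-dressed form kills `W₁` on both sides (`𝒮 = [[𝒮₁₁,0],[0,0]]`), `(𝒮^{nest})₁₁ = Π^{cᵀ}·𝒮₁₁·Π^c`: the block step of the nested composite IS the block-dressed block step

HONEST DEPENDENCY (page 1, mandatory): continuum YM on T⁴ ⇐ BetaPertH ∧ nine spine estimates (0/9 proved); BetaPertH ⇐ (D1) ∧ (D4) ∧ CAP+tail;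
G-an2-4 gates asym, D1 and NE2/3/4.  HONEST FRAMING (cell contract, verbatim): «discharging `BetaPertH` makes Bałaban's UV stability UNCONDITIONAL —
a real constructive-QFT result; it is NOT the continuum limit and NOT the Clay problem.»  THIS MODULE DISCHARGES NOTHING of the wall: [folklore] finite-dimensional
linear algebra over an arbitrary field (a block-triangular inverse; the uniqueness of the bordered inverse's columns) composed BY NAME with the owner's
`NestedDressingStepLaw` ∕ `ComposedSliceGhostFactor` and the cell's `CompositionSingular` (`kkt_mul_blocks`, `mul_minOp`) ∕ `GaugeFixingPropagators`
(`effForm_slice_eq_fromBlocks`).  No `def`, no `def … : Prop`, nothing cited, 0 sorry; 0∕4 row-D1 binders; NOT SDF for the literal (the dictionary (β) from road FP's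
perfect objects to `(H, Q₁, τ₁, S₁, S^c, W₁, W₂)` stays DISPLAYED), NOT D1, NOT BetaPertH, NOT continuum, NOT Clay.  «not in print; our bookkeeping».

ABSOLUTE RULE (cell charter, verbatim): «No internally-minted statement may enter as a cited fact. Every hypothesis is either kernel-proved in this package or a
verbatim quotation of a PUBLISHED theorem with page reference. The manuscript(s) under audit are NOT citable for their own disputed steps — they are the thing
under adjudication; programme-internal (2001/route/tribunal) claims are never citable.»

WHY (memo `HOME/b2b-balaban-beta-d1-p3/N2B-DESIGN.md` v2 §9 (9d)–(9e)).  `NestedDressingStepLaw.det_kkt_comp_nestedDressed` composes the one-shot sliced determinant of the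
nested-dressed form as (one-step-dressed fine determinant) × (determinant of the block system of `𝒮₁₁(Π_nestᵀHΠ_nest,[Q₁;τ₁])`) × form-independent constants.  For the
road this block system must be the m-fold coarse object again — row (β-c).  This file proves the model-level content of (β-c): the block form of the nested-dressed system is
the congruence by the block-level gauge projector `Π^c` of the block form of the one-step-dressed system (so at the coarse level the same structure recurs with
`(𝒮₁₁, Q₂, S^c, Q₁W₂)` in place of `(H, Q₁, S₁, W₁)`), by exhibiting the minimiser of the nested system in terms of the one-step minimiser and invoking the uniqueness of
the bordered inverse.

CONTENTS (all [folklore]; notation of `NestedDressingStepLaw`: `τ̃ := fromRows (S^c·Q₁) S₁`, `W := fromCols W₂ W₁`, `Π_nest := 1 − W(τ̃W)⁻¹τ̃`, `Π₁ := 1 − W₁(S₁W₁)⁻¹S₁`,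
`G := 1 − W₂(S^cQ₁W₂)⁻¹(S^cQ₁)`, `Π^c := 1 − (Q₁W₂)(S^cQ₁W₂)⁻¹S^c`; hypotheses `Q₁W₁ = 0`, `S₁W₁` and `S^cQ₁W₂` invertible).
* §1 `inv_composedSlice_mul_composedSlice` (`(τ̃W)⁻¹τ̃ = [U; V]` explicitly), **`nestedProj_eq_fineProj_mul`** (`Π_nest = Π₁·G`), `avg_mul_coarseAdj` (`Q₁G = Π^cQ₁`),
  `coarseAdj_mul_W₂` (`GW₂ = 0`), `coarseSlice_mul_coarseProj` (`S^cΠ^c = 0`).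
* §2 `effForm_firstCol_unique`: if `K·A + Cᵀ·B = 0` and `C·A = [1;0]`-columns then `−B` is the first block column of `effForm K C` (uniqueness of the bordered inverse).
* §3 **`effForm_nestedDressed_firstCol`**: `effForm (Π_nestᵀHΠ_nest) [Q₁;τ₁] · [1;0] = (Mᵀ · effForm (Π₁ᵀHΠ₁) [Q₁;τ₁] · M) · [1;0]` with `M := fromBlocks Π^c 0 (−τ₁W₂(S^cQ₁W₂)⁻¹S^c) 1`,
  and **`effForm₁₁_nestedDressed_of_slice`**: `= Π^{cᵀ}·(effForm (Π₁ᵀHΠ₁) [Q₁;τ₁]).toBlocks₁₁·Π^c` once `Π₁ᵀHΠ₁` has the two-sided null directions `W₁` and its sliced system is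
  invertible (`GaugeFixingPropagators.effForm_slice_eq_fromBlocks`); **`effForm_nestedDressed_eq_conj`**: the full identity `𝒮(Π_nestᵀHΠ_nest,[Q₁;τ₁]) = Mᵀ·𝒮(Π₁ᵀHΠ₁,[Q₁;τ₁])·M`.
Provenance: road FP OWNER b2b-balaban-beta-d1-p3 gen 14 (prover-b2b-balaban-beta-d1-p3-g14-0), 2026-08-21; PROPOSED RULING R-FP-45 (B), row (β-c) at model level.  Orientation only
(nothing quoted is load-bearing): [Balaban1985BackgroundPropagators] Sect. D (3.115)–(3.126) (the minimiser and the gauge transformation onto the slice); textbook linear algebra.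
-/

namespace Summit.QuantumFields.BalabanUV.Beta.FP.NestedDressingDescent

noncomputable section

open Literature.MathematicalPhysics.QuantumFieldTheory.Balaban1983to89.Beta.Composition
open Literature.MathematicalPhysics.QuantumFieldTheory.Balaban1983to89.Beta.CompositionSingular
open Literature.MathematicalPhysics.QuantumFieldTheory.Balaban1983to89.Beta.GaugeFixingPropagators
open Summit.QuantumFields.BalabanUV.Beta.FP.ComposedSliceGhostFactor
open Summit.QuantumFields.BalabanUV.Beta.FP.NestedDressingStepLaw
open scoped Matrix
open Matrix

variable {𝕜 : Type*} [Field 𝕜]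
variable {ν μ ρ ρ₁ ρ₂ : Type*} [Fintype ν] [Fintype μ] [Fintype ρ] [Fintype ρ₁] [Fintype ρ₂]
  [DecidableEq ν] [DecidableEq μ] [DecidableEq ρ] [DecidableEq ρ₁] [DecidableEq ρ₂]

/-! ## §1 `Π_nest = Π₁ · G` and the block-level projector -/

section Factor

omit [Fintype ρ] [DecidableEq ρ] [DecidableEq ν] [DecidableEq μ] in
/-- [folklore] The composed dressing slice applied through `(τ̃W)⁻¹`: `(τ̃W)⁻¹·τ̃ = [U; V]`, `U = (S^cQ₁W₂)⁻¹S^cQ₁`, `V = (S₁W₁)⁻¹(S₁ − S₁W₂U)` (block-triangular inverse). -/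
theorem inv_composedSlice_mul_composedSlice (Q₁ : Matrix μ ν 𝕜) (S₁ : Matrix ρ₁ ν 𝕜) (Sc : Matrix ρ₂ μ 𝕜) (W₁ : Matrix ν ρ₁ 𝕜) (W₂ : Matrix ν ρ₂ 𝕜)
    (hQW₁ : Q₁ * W₁ = 0) (hT : IsUnit (S₁ * W₁).det) (hTc : IsUnit (Sc * (Q₁ * W₂)).det) :
    (fromRows (Sc * Q₁) S₁ * fromCols W₂ W₁)⁻¹ * fromRows (Sc * Q₁) S₁ =
      fromRows ((Sc * (Q₁ * W₂))⁻¹ * (Sc * Q₁))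
        ((S₁ * W₁)⁻¹ * (S₁ - S₁ * W₂ * ((Sc * (Q₁ * W₂))⁻¹ * (Sc * Q₁)))) := by
  have hU := isUnit_det_composedSlice_mul Q₁ S₁ Sc W₁ W₂ hQW₁ hT hTc
  have hsol : fromRows (Sc * Q₁) S₁ * fromCols W₂ W₁ *
      fromRows ((Sc * (Q₁ * W₂))⁻¹ * (Sc * Q₁)) ((S₁ * W₁)⁻¹ * (S₁ - S₁ * W₂ * ((Sc * (Q₁ * W₂))⁻¹ * (Sc * Q₁)))) =
      fromRows (Sc * Q₁) S₁ := by
    rw [fromRows_mul_fromCols, fromBlocks_mul_fromRows]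
    congr 1
    · rw [Matrix.mul_assoc Sc Q₁ W₁, hQW₁, Matrix.mul_zero, Matrix.zero_mul, add_zero, ← Matrix.mul_assoc,
        Matrix.mul_assoc Sc Q₁ W₂, Matrix.mul_nonsing_inv _ hTc, Matrix.one_mul]
    · rw [← Matrix.mul_assoc (S₁ * W₁), Matrix.mul_nonsing_inv _ hT, Matrix.one_mul, add_sub_cancel]
  have h2 : (fromRows (Sc * Q₁) S₁ * fromCols W₂ W₁)⁻¹ * (fromRows (Sc * Q₁) S₁ * fromCols W₂ W₁ *
      fromRows ((Sc * (Q₁ * W₂))⁻¹ * (Sc * Q₁)) ((S₁ * W₁)⁻¹ * (S₁ - S₁ * W₂ * ((Sc * (Q₁ * W₂))⁻¹ * (Sc * Q₁))))) =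
      (fromRows (Sc * Q₁) S₁ * fromCols W₂ W₁)⁻¹ * fromRows (Sc * Q₁) S₁ := by rw [hsol]
  rw [← Matrix.mul_assoc, Matrix.nonsing_inv_mul _ hU, Matrix.one_mul] at h2
  exact h2.symm

omit [Fintype ρ] [DecidableEq ρ] [DecidableEq μ] in
/-- [folklore] **`Π_nest = Π₁ · G`**, `G := 1 − W₂(S^cQ₁W₂)⁻¹(S^cQ₁)`: the nested projector is the one-step projector AFTER the coarse gauge adjustment that puts the
averaged field into the block slice. -/
theorem nestedProj_eq_fineProj_mul (Q₁ : Matrix μ ν 𝕜) (S₁ : Matrix ρ₁ ν 𝕜) (Sc : Matrix ρ₂ μ 𝕜) (W₁ : Matrix ν ρ₁ 𝕜) (W₂ : Matrix ν ρ₂ 𝕜)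
    (hQW₁ : Q₁ * W₁ = 0) (hT : IsUnit (S₁ * W₁).det) (hTc : IsUnit (Sc * (Q₁ * W₂)).det) :
    (1 - fromCols W₂ W₁ * (fromRows (Sc * Q₁) S₁ * fromCols W₂ W₁)⁻¹ * fromRows (Sc * Q₁) S₁) =
      (1 - W₁ * (S₁ * W₁)⁻¹ * S₁) * (1 - W₂ * (Sc * (Q₁ * W₂))⁻¹ * (Sc * Q₁)) := by
  rw [Matrix.mul_assoc (fromCols W₂ W₁), inv_composedSlice_mul_composedSlice Q₁ S₁ Sc W₁ W₂ hQW₁ hT hTc, fromCols_mul_fromRows]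
  simp only [Matrix.mul_sub, Matrix.sub_mul, Matrix.mul_one, Matrix.one_mul, Matrix.mul_assoc]
  abel

omit [Fintype ρ] [Fintype ρ₁] [DecidableEq ρ] [DecidableEq ρ₁] in
/-- [folklore] The averaging intertwines the coarse gauge adjustment with the block-level projector: `Q₁·G = Π^c·Q₁`. -/
theorem avg_mul_coarseAdj (Q₁ : Matrix μ ν 𝕜) (Sc : Matrix ρ₂ μ 𝕜) (W₂ : Matrix ν ρ₂ 𝕜) :
    Q₁ * (1 - W₂ * (Sc * (Q₁ * W₂))⁻¹ * (Sc * Q₁)) = (1 - Q₁ * W₂ * (Sc * (Q₁ * W₂))⁻¹ * Sc) * Q₁ := by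
  rw [Matrix.mul_sub, Matrix.mul_one, Matrix.sub_mul, Matrix.one_mul]
  simp only [Matrix.mul_assoc]

omit [Fintype ρ] [Fintype ρ₁] [DecidableEq ρ] [DecidableEq ρ₁] [DecidableEq μ] in
/-- [folklore] The coarse gauge adjustment kills the block gauge directions: `G·W₂ = 0`. -/
theorem coarseAdj_mul_W₂ (Q₁ : Matrix μ ν 𝕜) (Sc : Matrix ρ₂ μ 𝕜) (W₂ : Matrix ν ρ₂ 𝕜) (hTc : IsUnit (Sc * (Q₁ * W₂)).det) :
    (1 - W₂ * (Sc * (Q₁ * W₂))⁻¹ * (Sc * Q₁)) * W₂ = 0 := by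
  rw [Matrix.sub_mul, Matrix.one_mul, Matrix.mul_assoc, Matrix.mul_assoc, Matrix.mul_assoc Sc Q₁ W₂, Matrix.nonsing_inv_mul _ hTc,
    Matrix.mul_one, sub_self]

omit [Fintype ρ] [Fintype ρ₁] [DecidableEq ρ] [DecidableEq ρ₁] [Fintype ν] [DecidableEq ν] in
/-- [folklore] The block slice kills the block-level projector: `S^c·Π^c = 0`. -/
theorem coarseSlice_mul_coarseProj (X : Matrix μ ρ₂ 𝕜) (Sc : Matrix ρ₂ μ 𝕜) (hTc : IsUnit (Sc * X).det) :
    Sc * (1 - X * (Sc * X)⁻¹ * Sc) = 0 := by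
  rw [Matrix.mul_sub, Matrix.mul_one, ← Matrix.mul_assoc, ← Matrix.mul_assoc, Matrix.mul_nonsing_inv _ hTc, Matrix.one_mul, sub_self]

end Factor

/-! ## §2 Uniqueness of the bordered inverse's columns: how to recognise the first block column of an effective form -/

section Unique

/-- [folklore] **RECOGNISING THE EFFECTIVE FORM.**  For the sliced constraint `C = [Q₁;τ₁]` with `kkt K C` invertible: if `A : Matrix ν μ 𝕜` and
`B : Matrix (μ ⊕ ρ) μ 𝕜` satisfy `K·A + Cᵀ·B = 0`, `Q₁·A = 1`, `τ₁·A = 0`, then `−B` is the first block column of the effective form: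
`effForm K C · [1; 0] = −B` (the `(ν ⊕ (μ ⊕ ρ)) × μ` matrix `[A; B]` solves the system whose unique solution is `kkt⁻¹·[0; [1;0]] = [ℋ·[1;0]; −𝒮·[1;0]]`). -/
theorem effForm_firstCol_unique (K : Matrix ν ν 𝕜) (Q₁ : Matrix μ ν 𝕜) (τ₁ : Matrix ρ ν 𝕜) (h : IsUnit (kkt K (fromRows Q₁ τ₁)).det)
    (A : Matrix ν μ 𝕜) (B : Matrix (μ ⊕ ρ) μ 𝕜) (hKA : K * A + (fromRows Q₁ τ₁)ᵀ * B = 0) (hQA : Q₁ * A = 1) (hτA : τ₁ * A = 0) :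
    effForm K (fromRows Q₁ τ₁) * fromRows (1 : Matrix μ μ 𝕜) (0 : Matrix ρ μ 𝕜) = -B := by
  -- the candidate solves `kkt · [A; B] = [0; [1;0]]`
  have hsys : kkt K (fromRows Q₁ τ₁) * fromRows A B = fromRows (0 : Matrix ν μ 𝕜) (fromRows (1 : Matrix μ μ 𝕜) (0 : Matrix ρ μ 𝕜)) := by
    rw [kkt_eq_fromBlocks, fromBlocks_mul_fromRows, Matrix.zero_mul, add_zero, hKA, fromRows_mul, hQA, hτA]
  -- hence `[A; B] = kkt⁻¹ · [0; [1;0]]`, whose lower block is `−𝒮·[1;0]`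
  have hsol : fromRows A B = (kkt K (fromRows Q₁ τ₁))⁻¹ * fromRows (0 : Matrix ν μ 𝕜) (fromRows (1 : Matrix μ μ 𝕜) (0 : Matrix ρ μ 𝕜)) := by
    rw [← hsys, ← Matrix.mul_assoc, Matrix.nonsing_inv_mul _ h, Matrix.one_mul]
  rw [kktInv_eq_fromBlocks, fromBlocks_mul_fromRows, Matrix.mul_zero, Matrix.mul_zero, zero_add, zero_add] at hsol
  have h2 := (fromRows_inj hsol).2
  rw [h2, Matrix.neg_mul, neg_neg]

end Unique

/-! ## §3 The nested dressing descends to the block form -/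

section Descent

/-- [folklore] **THE NESTED DRESSING DESCENDS TO THE BLOCK FORM.**  With `K₁ := Π₁ᵀHΠ₁` (one-step-dressed form) and `K♮ := Π_nestᵀHΠ_nest` (nested-dressed form), `C := [Q₁;τ₁]`,
both sliced systems invertible, and the block-level matrix `M := fromBlocks Π^c 0 (−τ₁W₂(S^cQ₁W₂)⁻¹S^c) 1`:
`effForm K♮ C · [1;0] = (Mᵀ · effForm K₁ C · M) · [1;0]` — the first block column (in particular the physical corner `(·)₁₁`) of the nested system's effective form is that
of the block-level congruence of the one-step system's effective form.  Proof: the nested minimiser is `ℋ₁·M·[1;0] + W₂(S^cQ₁W₂)⁻¹S^c` (`ℋ₁ = minOp K₁ C`), and §2. -/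
theorem effForm_nestedDressed_firstCol (H : Matrix ν ν 𝕜) (Q₁ : Matrix μ ν 𝕜) (τ₁ : Matrix ρ ν 𝕜) (S₁ : Matrix ρ₁ ν 𝕜) (Sc : Matrix ρ₂ μ 𝕜)
    (W₁ : Matrix ν ρ₁ 𝕜) (W₂ : Matrix ν ρ₂ 𝕜) (hQW₁ : Q₁ * W₁ = 0) (hT : IsUnit (S₁ * W₁).det) (hTc : IsUnit (Sc * (Q₁ * W₂)).det)
    (h1 : IsUnit (kkt ((1 - W₁ * (S₁ * W₁)⁻¹ * S₁)ᵀ * H * (1 - W₁ * (S₁ * W₁)⁻¹ * S₁)) (fromRows Q₁ τ₁)).det)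
    (hN : IsUnit (kkt ((1 - fromCols W₂ W₁ * (fromRows (Sc * Q₁) S₁ * fromCols W₂ W₁)⁻¹ * fromRows (Sc * Q₁) S₁)ᵀ * H *
          (1 - fromCols W₂ W₁ * (fromRows (Sc * Q₁) S₁ * fromCols W₂ W₁)⁻¹ * fromRows (Sc * Q₁) S₁)) (fromRows Q₁ τ₁)).det) :
    effForm ((1 - fromCols W₂ W₁ * (fromRows (Sc * Q₁) S₁ * fromCols W₂ W₁)⁻¹ * fromRows (Sc * Q₁) S₁)ᵀ * H *
          (1 - fromCols W₂ W₁ * (fromRows (Sc * Q₁) S₁ * fromCols W₂ W₁)⁻¹ * fromRows (Sc * Q₁) S₁)) (fromRows Q₁ τ₁) *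
        fromRows (1 : Matrix μ μ 𝕜) (0 : Matrix ρ μ 𝕜) =
      (fromBlocks (1 - Q₁ * W₂ * (Sc * (Q₁ * W₂))⁻¹ * Sc) (0 : Matrix μ ρ 𝕜) (-(τ₁ * W₂ * (Sc * (Q₁ * W₂))⁻¹ * Sc)) (1 : Matrix ρ ρ 𝕜))ᵀ *
          effForm ((1 - W₁ * (S₁ * W₁)⁻¹ * S₁)ᵀ * H * (1 - W₁ * (S₁ * W₁)⁻¹ * S₁)) (fromRows Q₁ τ₁) *
          fromBlocks (1 - Q₁ * W₂ * (Sc * (Q₁ * W₂))⁻¹ * Sc) (0 : Matrix μ ρ 𝕜) (-(τ₁ * W₂ * (Sc * (Q₁ * W₂))⁻¹ * Sc)) (1 : Matrix ρ ρ 𝕜) *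
        fromRows (1 : Matrix μ μ 𝕜) (0 : Matrix ρ μ 𝕜) := by
  -- names
  set P1 : Matrix ν ν 𝕜 := 1 - W₁ * (S₁ * W₁)⁻¹ * S₁ with hP1
  set PN : Matrix ν ν 𝕜 := 1 - fromCols W₂ W₁ * (fromRows (Sc * Q₁) S₁ * fromCols W₂ W₁)⁻¹ * fromRows (Sc * Q₁) S₁ with hPN
  set E : Matrix ν ν 𝕜 := W₂ * (Sc * (Q₁ * W₂))⁻¹ * (Sc * Q₁) with hE
  set G : Matrix ν ν 𝕜 := 1 - E with hG
  set Pc : Matrix μ μ 𝕜 := 1 - Q₁ * W₂ * (Sc * (Q₁ * W₂))⁻¹ * Sc with hPc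
  set X : Matrix ρ μ 𝕜 := -(τ₁ * W₂ * (Sc * (Q₁ * W₂))⁻¹ * Sc) with hX
  set M : Matrix (μ ⊕ ρ) (μ ⊕ ρ) 𝕜 := fromBlocks Pc 0 X 1 with hM
  set C : Matrix (μ ⊕ ρ) ν 𝕜 := fromRows Q₁ τ₁ with hC
  set K₁ : Matrix ν ν 𝕜 := P1ᵀ * H * P1 with hK₁
  set H₁ : Matrix ν (μ ⊕ ρ) 𝕜 := minOp K₁ C with hH₁
  set J : Matrix (μ ⊕ ρ) μ 𝕜 := fromRows (1 : Matrix μ μ 𝕜) (0 : Matrix ρ μ 𝕜) with hJ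
  -- structural facts
  have hPNfac : PN = P1 * G := by
    rw [hPN, hP1, hG, hE]; exact nestedProj_eq_fineProj_mul Q₁ S₁ Sc W₁ W₂ hQW₁ hT hTc
  have hQG : Q₁ * G = Pc * Q₁ := by rw [hG, hE, hPc]; exact avg_mul_coarseAdj Q₁ Sc W₂
  have hτG : τ₁ * G = X * Q₁ + τ₁ := by
    rw [hG, hE, hX, Matrix.mul_sub, Matrix.mul_one, Matrix.neg_mul]
    simp only [Matrix.mul_assoc]
    abel
  have hCG : C * G = M * C := by
    rw [hC, hM, fromRows_mul, fromBlocks_mul_fromRows, Matrix.zero_mul, add_zero, Matrix.one_mul, hQG, hτG]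
  have hMJ : M * J = fromRows Pc X := by
    rw [hM, hJ, fromBlocks_mul_fromRows]; simp
  have hGW₂ : G * W₂ = 0 := by rw [hG, hE]; exact coarseAdj_mul_W₂ Q₁ Sc W₂ hTc
  have hScPc : Sc * Pc = 0 := by rw [hPc]; exact coarseSlice_mul_coarseProj (Q₁ * W₂) Sc hTc
  -- the one-step minimiser's defining identities
  have hCH₁ : C * H₁ = 1 := by rw [hH₁]; exact mul_minOp K₁ C h1
  have hKH₁ : K₁ * H₁ = Cᵀ * effForm K₁ C := by rw [hH₁]; exact (kkt_mul_blocks K₁ C h1).2.1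
  have hQ₁C : Q₁ = fromCols (1 : Matrix μ μ 𝕜) (0 : Matrix μ ρ 𝕜) * C := by
    rw [hC, fromCols_mul_fromRows, Matrix.one_mul, Matrix.zero_mul, add_zero]
  have hτ₁C : τ₁ = fromCols (0 : Matrix ρ μ 𝕜) (1 : Matrix ρ ρ 𝕜) * C := by
    rw [hC, fromCols_mul_fromRows, Matrix.one_mul, Matrix.zero_mul, zero_add]
  have hQH : Q₁ * H₁ = fromCols (1 : Matrix μ μ 𝕜) (0 : Matrix μ ρ 𝕜) := by rw [hQ₁C, Matrix.mul_assoc, hCH₁, Matrix.mul_one]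
  have hτH : τ₁ * H₁ = fromCols (0 : Matrix ρ μ 𝕜) (1 : Matrix ρ ρ 𝕜) := by rw [hτ₁C, Matrix.mul_assoc, hCH₁, Matrix.mul_one]
  -- the candidate minimiser of the nested system
  set A : Matrix ν μ 𝕜 := H₁ * (M * J) + W₂ * (Sc * (Q₁ * W₂))⁻¹ * Sc with hA
  have hQA : Q₁ * A = 1 := by
    rw [hA, Matrix.mul_add, ← Matrix.mul_assoc Q₁ H₁ (M * J), hQH, hMJ, fromCols_mul_fromRows, Matrix.one_mul, Matrix.zero_mul,
      add_zero, hPc]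
    simp only [Matrix.mul_assoc]
    abel
  have hτA : τ₁ * A = 0 := by
    rw [hA, Matrix.mul_add, ← Matrix.mul_assoc τ₁ H₁ (M * J), hτH, hMJ, fromCols_mul_fromRows, Matrix.zero_mul, Matrix.one_mul,
      zero_add, hX]
    simp only [Matrix.mul_assoc]
    abel
  -- `G` moves the candidate onto the one-step minimiser: `G·A = ℋ₁·M·J`
  have hE0 : E * (H₁ * (M * J)) = 0 := by
    rw [hE, hMJ]
    simp only [Matrix.mul_assoc]
    rw [← Matrix.mul_assoc Q₁ H₁, hQH, fromCols_mul_fromRows, Matrix.one_mul, Matrix.zero_mul, add_zero, hScPc,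
      Matrix.mul_zero, Matrix.mul_zero]
  have hGA : G * A = H₁ * (M * J) := by
    rw [hA, Matrix.mul_add, hG, Matrix.sub_mul, Matrix.one_mul, hE0, sub_zero, ← hG, Matrix.mul_assoc W₂, ← Matrix.mul_assoc G W₂,
      hGW₂, Matrix.zero_mul, add_zero]
  -- Euler–Lagrange for the nested form at the candidate: `K♮·A = Cᵀ·(Mᵀ𝒮₁M)·J`
  have e1 : PNᵀ * H * PN * A = Cᵀ * (Mᵀ * effForm K₁ C * M * J) := by
    rw [hPNfac, Matrix.transpose_mul]
    calc Gᵀ * P1ᵀ * H * (P1 * G) * A = Gᵀ * (P1ᵀ * H * P1) * (G * A) := by simp only [Matrix.mul_assoc]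
      _ = Gᵀ * K₁ * (H₁ * (M * J)) := by rw [← hK₁, hGA]
      _ = Gᵀ * (K₁ * H₁) * (M * J) := by simp only [Matrix.mul_assoc]
      _ = Gᵀ * (Cᵀ * effForm K₁ C) * (M * J) := by rw [hKH₁]
      _ = (C * G)ᵀ * effForm K₁ C * (M * J) := by rw [Matrix.transpose_mul]; simp only [Matrix.mul_assoc]
      _ = (M * C)ᵀ * effForm K₁ C * (M * J) := by rw [hCG]
      _ = Cᵀ * (Mᵀ * effForm K₁ C * M * J) := by rw [Matrix.transpose_mul]; simp only [Matrix.mul_assoc]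
  have hKA : PNᵀ * H * PN * A + Cᵀ * (-(Mᵀ * effForm K₁ C * M * J)) = 0 := by
    rw [e1, Matrix.mul_neg, add_neg_cancel]
  -- conclude by uniqueness
  have hfin := effForm_firstCol_unique (PNᵀ * H * PN) Q₁ τ₁ hN A _ hKA hQA hτA
  rw [neg_neg] at hfin
  rw [hJ] at hfin ⊢
  rw [hfin]

/-- [folklore] **… HENCE `(𝒮^{nest})₁₁ = Π^{cᵀ}·𝒮₁₁·Π^c` WHEN THE ONE-STEP-DRESSED FORM KILLS `W₁` ON BOTH SIDES** (`GaugeFixingPropagators.effForm_slice_eq_fromBlocks`: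
then `effForm (Π₁ᵀHΠ₁) [Q₁;τ₁] = fromBlocks 𝒮₁₁ 0 0 0`, so the congruence by `M` reads `Π^{cᵀ}𝒮₁₁Π^c` on the physical corner): the block form of the nested-dressed
composite is the BLOCK-DRESSED block form — the same structure one level down, with `(𝒮₁₁, Π^c)` in place of `(H, Π₁)`.  (`Π₁ᵀHΠ₁` kills `W₁` on the right by
`fineProj_mul_W₁`; the transposed condition `(Π₁ᵀHΠ₁)ᵀW₁ = 0` holds likewise since `(Π₁ᵀHΠ₁)ᵀ = Π₁ᵀHᵀΠ₁`.) -/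
theorem effForm₁₁_nestedDressed_of_slice (H : Matrix ν ν 𝕜) (Q₁ : Matrix μ ν 𝕜) (τ₁ : Matrix ρ₁ ν 𝕜) (S₁ : Matrix ρ₁ ν 𝕜) (Sc : Matrix ρ₂ μ 𝕜)
    (W₁ : Matrix ν ρ₁ 𝕜) (W₂ : Matrix ν ρ₂ 𝕜) (hQW₁ : Q₁ * W₁ = 0) (hT : IsUnit (S₁ * W₁).det) (hTc : IsUnit (Sc * (Q₁ * W₂)).det)
    (hτ : IsUnit (τ₁ * W₁).det)
    (h1 : IsUnit (kkt ((1 - W₁ * (S₁ * W₁)⁻¹ * S₁)ᵀ * H * (1 - W₁ * (S₁ * W₁)⁻¹ * S₁)) (fromRows Q₁ τ₁)).det)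
    (hN : IsUnit (kkt ((1 - fromCols W₂ W₁ * (fromRows (Sc * Q₁) S₁ * fromCols W₂ W₁)⁻¹ * fromRows (Sc * Q₁) S₁)ᵀ * H *
          (1 - fromCols W₂ W₁ * (fromRows (Sc * Q₁) S₁ * fromCols W₂ W₁)⁻¹ * fromRows (Sc * Q₁) S₁)) (fromRows Q₁ τ₁)).det) :
    (effForm ((1 - fromCols W₂ W₁ * (fromRows (Sc * Q₁) S₁ * fromCols W₂ W₁)⁻¹ * fromRows (Sc * Q₁) S₁)ᵀ * H *
          (1 - fromCols W₂ W₁ * (fromRows (Sc * Q₁) S₁ * fromCols W₂ W₁)⁻¹ * fromRows (Sc * Q₁) S₁)) (fromRows Q₁ τ₁)).toBlocks₁₁ =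
      (1 - Q₁ * W₂ * (Sc * (Q₁ * W₂))⁻¹ * Sc)ᵀ *
        (effForm ((1 - W₁ * (S₁ * W₁)⁻¹ * S₁)ᵀ * H * (1 - W₁ * (S₁ * W₁)⁻¹ * S₁)) (fromRows Q₁ τ₁)).toBlocks₁₁ *
        (1 - Q₁ * W₂ * (Sc * (Q₁ * W₂))⁻¹ * Sc) := by
  set P1 : Matrix ν ν 𝕜 := 1 - W₁ * (S₁ * W₁)⁻¹ * S₁ with hP1
  set K₁ : Matrix ν ν 𝕜 := P1ᵀ * H * P1 with hK₁
  set S11 : Matrix μ μ 𝕜 := (effForm K₁ (fromRows Q₁ τ₁)).toBlocks₁₁ with hS11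
  -- the one-step-dressed form has the two-sided null directions `W₁`
  have hPW : P1 * W₁ = 0 := by rw [hP1]; exact fineProj_mul_W₁ S₁ W₁ hT
  have hKW : K₁ * W₁ = 0 := by rw [hK₁, Matrix.mul_assoc, hPW, Matrix.mul_zero]
  have hKtW : K₁ᵀ * W₁ = 0 := by
    rw [hK₁, Matrix.transpose_mul, Matrix.transpose_mul, Matrix.transpose_transpose, Matrix.mul_assoc, Matrix.mul_assoc, hPW,
      Matrix.mul_zero, Matrix.mul_zero]
  have hS : effForm K₁ (fromRows Q₁ τ₁) = fromBlocks S11 0 0 0 := by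
    rw [hS11]; exact effForm_slice_eq_fromBlocks K₁ Q₁ τ₁ W₁ hKW hKtW hQW₁ hτ h1
  -- the top block of `X·[1;0]` is `X₁₁`
  have key : ∀ X : Matrix (μ ⊕ ρ₁) (μ ⊕ ρ₁) 𝕜,
      (X * fromRows (1 : Matrix μ μ 𝕜) (0 : Matrix ρ₁ μ 𝕜)).toRows₁ = X.toBlocks₁₁ := by
    intro X
    conv_lhs => rw [← fromBlocks_toBlocks X]
    rw [fromBlocks_mul_fromRows, toRows₁_fromRows, Matrix.mul_one, Matrix.mul_zero, add_zero]
  have hcol := effForm_nestedDressed_firstCol H Q₁ τ₁ S₁ Sc W₁ W₂ hQW₁ hT hTc h1 hN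
  have htop := congrArg Matrix.toRows₁ hcol
  rw [key] at htop
  rw [htop, hS, fromBlocks_transpose, Matrix.mul_assoc, Matrix.mul_assoc, fromBlocks_mul_fromRows, fromBlocks_mul_fromRows,
    fromBlocks_mul_fromRows, toRows₁_fromRows]
  simp [Matrix.mul_assoc]


/-- [folklore] **… AND AS A FULL IDENTITY OF EFFECTIVE FORMS**: under the same hypotheses, `effForm (Π_nestᵀHΠ_nest) [Q₁;τ₁] = Mᵀ · effForm (Π₁ᵀHΠ₁) [Q₁;τ₁] · M`
(`M = fromBlocks Π^c 0 (−τ₁W₂(S^cQ₁W₂)⁻¹S^c) 1`): both forms kill `W₁` on both sides, so by `GaugeFixingPropagators.effForm_slice_eq_fromBlocks` both effective forms are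
`[[·,0],[0,0]]`, and the physical corners agree by `effForm₁₁_nestedDressed_of_slice`. -/
theorem effForm_nestedDressed_eq_conj (H : Matrix ν ν 𝕜) (Q₁ : Matrix μ ν 𝕜) (τ₁ : Matrix ρ₁ ν 𝕜) (S₁ : Matrix ρ₁ ν 𝕜) (Sc : Matrix ρ₂ μ 𝕜)
    (W₁ : Matrix ν ρ₁ 𝕜) (W₂ : Matrix ν ρ₂ 𝕜) (hQW₁ : Q₁ * W₁ = 0) (hT : IsUnit (S₁ * W₁).det) (hTc : IsUnit (Sc * (Q₁ * W₂)).det)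
    (hτ : IsUnit (τ₁ * W₁).det)
    (h1 : IsUnit (kkt ((1 - W₁ * (S₁ * W₁)⁻¹ * S₁)ᵀ * H * (1 - W₁ * (S₁ * W₁)⁻¹ * S₁)) (fromRows Q₁ τ₁)).det)
    (hN : IsUnit (kkt ((1 - fromCols W₂ W₁ * (fromRows (Sc * Q₁) S₁ * fromCols W₂ W₁)⁻¹ * fromRows (Sc * Q₁) S₁)ᵀ * H *
          (1 - fromCols W₂ W₁ * (fromRows (Sc * Q₁) S₁ * fromCols W₂ W₁)⁻¹ * fromRows (Sc * Q₁) S₁)) (fromRows Q₁ τ₁)).det) :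
    effForm ((1 - fromCols W₂ W₁ * (fromRows (Sc * Q₁) S₁ * fromCols W₂ W₁)⁻¹ * fromRows (Sc * Q₁) S₁)ᵀ * H *
          (1 - fromCols W₂ W₁ * (fromRows (Sc * Q₁) S₁ * fromCols W₂ W₁)⁻¹ * fromRows (Sc * Q₁) S₁)) (fromRows Q₁ τ₁) =
      (fromBlocks (1 - Q₁ * W₂ * (Sc * (Q₁ * W₂))⁻¹ * Sc) (0 : Matrix μ ρ₁ 𝕜) (-(τ₁ * W₂ * (Sc * (Q₁ * W₂))⁻¹ * Sc)) (1 : Matrix ρ₁ ρ₁ 𝕜))ᵀ *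
        effForm ((1 - W₁ * (S₁ * W₁)⁻¹ * S₁)ᵀ * H * (1 - W₁ * (S₁ * W₁)⁻¹ * S₁)) (fromRows Q₁ τ₁) *
        fromBlocks (1 - Q₁ * W₂ * (Sc * (Q₁ * W₂))⁻¹ * Sc) (0 : Matrix μ ρ₁ 𝕜) (-(τ₁ * W₂ * (Sc * (Q₁ * W₂))⁻¹ * Sc)) (1 : Matrix ρ₁ ρ₁ 𝕜) := by
  set P1 : Matrix ν ν 𝕜 := 1 - W₁ * (S₁ * W₁)⁻¹ * S₁ with hP1
  set PN : Matrix ν ν 𝕜 := 1 - fromCols W₂ W₁ * (fromRows (Sc * Q₁) S₁ * fromCols W₂ W₁)⁻¹ * fromRows (Sc * Q₁) S₁ with hPN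
  set K₁ : Matrix ν ν 𝕜 := P1ᵀ * H * P1 with hK₁
  set KN : Matrix ν ν 𝕜 := PNᵀ * H * PN with hKN
  -- both dressed forms have the two-sided null directions `W₁`
  have hPW : P1 * W₁ = 0 := by rw [hP1]; exact fineProj_mul_W₁ S₁ W₁ hT
  have hPNW : PN * W₁ = 0 := by rw [hPN]; exact nestedProj_mul_W₁ Q₁ S₁ Sc W₁ W₂ hQW₁ hT hTc
  have hKW : K₁ * W₁ = 0 := by rw [hK₁, Matrix.mul_assoc, hPW, Matrix.mul_zero]
  have hKtW : K₁ᵀ * W₁ = 0 := by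
    rw [hK₁, Matrix.transpose_mul, Matrix.transpose_mul, Matrix.transpose_transpose, Matrix.mul_assoc, Matrix.mul_assoc, hPW,
      Matrix.mul_zero, Matrix.mul_zero]
  have hKNW : KN * W₁ = 0 := by rw [hKN, Matrix.mul_assoc, hPNW, Matrix.mul_zero]
  have hKNtW : KNᵀ * W₁ = 0 := by
    rw [hKN, Matrix.transpose_mul, Matrix.transpose_mul, Matrix.transpose_transpose, Matrix.mul_assoc, Matrix.mul_assoc, hPNW,
      Matrix.mul_zero, Matrix.mul_zero]
  have hS₁ := effForm_slice_eq_fromBlocks K₁ Q₁ τ₁ W₁ hKW hKtW hQW₁ hτ h1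
  have hSN := effForm_slice_eq_fromBlocks KN Q₁ τ₁ W₁ hKNW hKNtW hQW₁ hτ hN
  have h11 := effForm₁₁_nestedDressed_of_slice H Q₁ τ₁ S₁ Sc W₁ W₂ hQW₁ hT hTc hτ h1 hN
  rw [← hKN, ← hK₁] at h11
  rw [hSN, h11, hS₁, toBlocks_fromBlocks₁₁, fromBlocks_transpose, fromBlocks_multiply, fromBlocks_multiply]
  simp [Matrix.mul_assoc]

end Descent

end

end Summit.QuantumFields.BalabanUV.Beta.FP.NestedDressingDescent
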